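import Summits.AtomisticToContinuum.HydrodynamicLimit.Theorems.CollisionIsometryCLTMacroClosureEngineDefs
import Summits.AtomisticToContinuum.HydrodynamicLimit.Theorems.CollisionIsometryCLTMacroClosureStubBalanceB1
import Summits.AtomisticToContinuum.HydrodynamicLimit.Theorems.CollisionIsometryCLTMacroClosureStubBalanceB2
import HarnessLib

/-!
# Sub-goal `engine_increment` of the lead's stub `stub_engine` (line `IdeatorTwoGen1Sketch`, crux
# `MacroClosure`, stmt-AtomisticToContinuum-14870): the pathwise increment of the tested observable

On a good trajectory `s ↦ Φ_s z` of a hard-sphere flow and for `τ ∈ [0, t]`, `0 < t < T`, the tested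
empirical observable `Obs(s, w) = ⟨emp w, λ⁰(s,·) + λᵐ(s,·)·v + λᴱ(s,·)|v|²/2⟩` of a classical hs-Euler
solution in the dilute chamber satisfies
`Obs(τ, Φ_τ z) − Obs(0, z) = ∫_{[0,τ]} kinFlux(s, Φ_s z) ds + ccRes(z, τ)`.

Proof. `Obs = ⟨emp, λ⁰⟩ + O` (finite empirical averages split termwise). The MASS part is conjunct
(B1) of `BalanceIdentity` (`stub_balance_B1`) applied to `λ⁰ = lam0 σ ρ θ u`, which is jointly smooth on
`[0, t] × T³` because it is the evaluation at the constant state `(1, 0, 0)` of the smooth entropy-variable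
field `Λ = Dη_σ(U_cl)` of `ThermoChamber` clause 3 (explicit form of `Λ`). The KINETIC part is the
definition of CTL's collisional residual `ccRes`, in which the free-transport derivative
`d/dr|₀ O(s, freeFlight r w)` is identified with the microscopic kinetic flux by conjunct (B2)
(`stub_balance_B2`; the tests `λᵐ(s,·) = θ⁻¹u`, `λᴱ(s,·) = −θ⁻¹` are smooth slices). Adding the two,
the time integrands of (B1) and of `ccRes` sum to the integrand of `kinFlux` at every interior time
`s ∈ (0, t)` (where the one-sided time derivative within `[0, t]` of `λ⁰` is the two-sided one), hence
a.e. on `[0, τ]`; splitting `∫ (f + g) = ∫ f + ∫ g` uses the integrability on `[0, τ]` of both integrands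
along the good trajectory (positions continuous, velocities constant between the finitely many collision
times in `[0, t]`: induction on the collision set, as in the (B1) file).
-/

noncomputable section

open MeasureTheory Filter Set Topology InformationTheory
open scoped ENNReal ContDiff

namespace Summit.AtomisticToContinuum.HydrodynamicLimit.Theorems.MacroClosureLine

open Literature.MathematicalPhysics.KineticTheory Literature.Analysis.FluidPDE
open Literature.Analysis.FunctionSpaces

namespace Barycentric

/-! ## Velocity-dependent observables along hard-sphere trajectories are integrable in time -/

section Trajectory

variable {N : ℕ} {ε : ℝ} {γ : ℝ → Config (N + 1) (Fin 3) T3}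

/-- Interval integrability of `s ↦ F (vᵢ(s)) s (xᵢ(s))` on a collision-free window `[a, b] ⊆ [0, t]`
along a hard-sphere trajectory, for a velocity-parametrised family of fields `F v` each jointly
continuous on `[0, t] × T³`: on `(a, b)` the velocity is constant, so the integrand agrees there with a
function continuous on `[a, b]` (generalises `traj_intervalIntegrable_of_free` of the (B1) file). -/
theorem traj_intervalIntegrable_vel_of_free
    (hγ : IsHardSphereTrajectory (Torus.geometry (Fin 3)) ε (N + 1) γ) {t : ℝ}
    {F : V3 → ℝ → T3 → ℝ} (hF : ∀ v, ContinuousOn (fun p : ℝ × T3 => F v p.1 p.2) (Icc 0 t ×ˢ univ))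
    (i : Fin (N + 1)) {a b : ℝ} (ha : 0 ≤ a) (hab : a ≤ b) (hb : b ≤ t)
    (hfree : ∀ τ ∈ Ioo a b, τ ∉ collisionTimes (Torus.geometry (Fin 3)) ε γ) :
    IntervalIntegrable (fun s => F (γ s i).2 s (γ s i).1) volume a b := by
  have hsub : Icc a b ⊆ Icc 0 t := Icc_subset_Icc ha hb
  have hcont : ContinuousOn (fun s => F (γ ((a + b) / 2) i).2 s (γ s i).1) (Icc a b) :=
    (traj_continuousOn_comp hγ (u := F (γ ((a + b) / 2) i).2) (hF _) i).mono hsub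
  have hint := (intervalIntegrable_iff_integrableOn_Ioo_of_le hab).1
    (hcont.intervalIntegrable_of_Icc (μ := volume) hab)
  refine (intervalIntegrable_iff_integrableOn_Ioo_of_le hab).2
    (hint.congr_fun (fun s hs => ?_) measurableSet_Ioo)
  have hm : (a + b) / 2 ∈ Ioo a b := ⟨by linarith [hs.1, hs.2], by linarith [hs.1, hs.2]⟩
  simp only [traj_vel_eq_of_free hγ hfree hm hs i]

/-- Interval integrability on `[0, τ] ⊆ [0, t]` of `s ↦ F (vᵢ(s)) s (xᵢ(s))` along a hard-sphere
trajectory, for a velocity-parametrised family of fields `F v` each jointly continuous on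
`[0, t] × T³`: induction on the finite set of collision times in `[0, t]`, splitting the window at each
of them (generalises `traj_intervalIntegrable` of the (B1) file). -/
theorem traj_intervalIntegrable_vel
    (hγ : IsHardSphereTrajectory (Torus.geometry (Fin 3)) ε (N + 1) γ) {t : ℝ}
    {F : V3 → ℝ → T3 → ℝ} (hF : ∀ v, ContinuousOn (fun p : ℝ × T3 => F v p.1 p.2) (Icc 0 t ×ˢ univ))
    (i : Fin (N + 1)) {τ : ℝ} (hτ : τ ∈ Icc 0 t) :
    IntervalIntegrable (fun s => F (γ s i).2 s (γ s i).1) volume 0 τ := by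
  classical
  suffices H : ∀ (D : Finset ℝ) (a b : ℝ), 0 ≤ a → a ≤ b → b ≤ t →
      (∀ c ∈ Ioo a b, c ∈ collisionTimes (Torus.geometry (Fin 3)) ε γ → c ∈ D) →
      IntervalIntegrable (fun s => F (γ s i).2 s (γ s i).1) volume a b by
    exact H (hγ.locFinite 0 t).toFinset 0 τ le_rfl hτ.1 hτ.2 fun c hc hcC =>
      (hγ.locFinite 0 t).mem_toFinset.2 ⟨hcC, hc.1.le, hc.2.le.trans hτ.2⟩
  intro D
  induction D using Finset.induction_on with
  | empty =>
    intro a b ha hab hb hD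
    exact traj_intervalIntegrable_vel_of_free hγ hF i ha hab hb fun c hc hcC => by
      simpa using hD c hc hcC
  | @insert c D _ ih =>
    intro a b ha hab hb hD
    by_cases hc : c ∈ Ioo a b
    · refine (ih a c ha hc.1.le (hc.2.le.trans hb) fun c' hc' hc'C => ?_).trans
        (ih c b (ha.trans hc.1.le) hc.2.le hb fun c' hc' hc'C => ?_)
      · exact (Finset.mem_insert.1 (hD c' ⟨hc'.1, hc'.2.trans hc.2⟩ hc'C)).resolve_left
          (ne_of_lt hc'.2)
      · exact (Finset.mem_insert.1 (hD c' ⟨hc.1.trans hc'.1, hc'.2⟩ hc'C)).resolve_left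
          (ne_of_gt hc'.1)
    · exact ih a b ha hab hb fun c' hc' hc'C =>
        (Finset.mem_insert.1 (hD c' hc' hc'C)).resolve_left fun h => hc (h ▸ hc')

/-- Integrability on `[0, τ] ⊆ [0, t]`, `t < T`, along a hard-sphere trajectory, of the kinetic
production `⟨emp(γ s), ∂ₛλᵐ·v + ∂ₛλᴱ|v|²/2⟩ + ⟨emp(γ s), Σⱼₖ ∂ⱼλᵐₖ vⱼvₖ + Σⱼ ∂ⱼλᴱ vⱼ|v|²/2⟩` (one-sided
time derivatives within `[0, T)`) for entropy variables `λᵐ`, `λᴱ` jointly smooth on `[0, T) × T³`: the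
empirical averages are finite sums of velocity-polynomial observables with jointly continuous
coefficients. -/
theorem kinetic_integrableOn (hγ : IsHardSphereTrajectory (Torus.geometry (Fin 3)) ε (N + 1) γ)
    {T : ℝ} {θ : ℝ → T3 → ℝ} {u : ℝ → T3 → V3} (hM : Torus.IsSmoothSpaceTimeOn (Ico 0 T) (lamM θ u))
    (hE : Torus.IsSmoothSpaceTimeOn (Ico 0 T) (lamE θ)) {t : ℝ} (htT : t < T) {τ : ℝ}
    (hτ : τ ∈ Icc 0 t) :
    IntegrableOn (fun s => (∫ y, ((∑ j, Torus.timeDerivWithin (Ico 0 T) (lamM θ u) s y.1 j * y.2 j) +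
        Torus.timeDerivWithin (Ico 0 T) (lamE θ) s y.1 * (‖y.2‖ ^ 2 / 2)) ∂(empiricalMeasure (γ s))) +
      ∫ y, ((∑ j, ∑ k, Torus.partialDeriv j (fun x => lamM θ u s x k) y.1 * (y.2 j * y.2 k)) +
        ∑ j, Torus.partialDeriv j (lamE θ s) y.1 * (y.2 j * (‖y.2‖ ^ 2 / 2))) ∂(empiricalMeasure (γ s)))
      (Icc 0 τ) volume := by
  have hS : UniqueDiffOn ℝ (Ico 0 T) := uniqueDiffOn_Ico 0 T
  have hsub : Icc 0 t ×ˢ (univ : Set T3) ⊆ Ico 0 T ×ˢ univ :=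
    prod_mono (Icc_subset_Ico_right htT) subset_rfl
  have cM : ∀ j, ContinuousOn (fun p : ℝ × T3 => Torus.timeDerivWithin (Ico 0 T) (lamM θ u) p.1 p.2 j)
      (Icc 0 t ×ˢ univ) := fun j =>
    (continuousOn_uncurry_of_stLift ((hM.timeDerivWithin hS).apply j).continuousOn_stLift).mono hsub
  have cE : ContinuousOn (fun p : ℝ × T3 => Torus.timeDerivWithin (Ico 0 T) (lamE θ) p.1 p.2)
      (Icc 0 t ×ˢ univ) :=
    (continuousOn_uncurry_of_stLift (hE.timeDerivWithin hS).continuousOn_stLift).mono hsub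
  have cMx : ∀ j k, ContinuousOn
      (fun p : ℝ × T3 => Torus.partialDeriv j (fun x => lamM θ u p.1 x k) p.2) (Icc 0 t ×ˢ univ) :=
    fun j k =>
    (continuousOn_uncurry_of_stLift ((hM.apply k).partialDeriv hS j).continuousOn_stLift).mono hsub
  have cEx : ∀ j, ContinuousOn (fun p : ℝ × T3 => Torus.partialDeriv j (lamE θ p.1) p.2)
      (Icc 0 t ×ˢ univ) := fun j =>
    (continuousOn_uncurry_of_stLift (hE.partialDeriv hS j).continuousOn_stLift).mono hsub
  simp only [integral_empiricalMeasure]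
  refine (Integrable.const_mul (integrable_finsetSum _ fun i _ => ?_) _).add
    (Integrable.const_mul (integrable_finsetSum _ fun i _ => ?_) _)
  · refine (intervalIntegrable_iff_integrableOn_Icc_of_le hτ.1).1
      (traj_intervalIntegrable_vel hγ (F := fun v s x =>
        (∑ j, Torus.timeDerivWithin (Ico 0 T) (lamM θ u) s x j * v j) +
          Torus.timeDerivWithin (Ico 0 T) (lamE θ) s x * (‖v‖ ^ 2 / 2)) (fun v => ?_) i hτ)
    exact (continuousOn_finsetSum _ fun j _ => (cM j).mul continuousOn_const).add
      (cE.mul continuousOn_const)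
  · refine (intervalIntegrable_iff_integrableOn_Icc_of_le hτ.1).1
      (traj_intervalIntegrable_vel hγ (F := fun v s x =>
        (∑ j, ∑ k, Torus.partialDeriv j (fun x => lamM θ u s x k) x * (v j * v k)) +
          ∑ j, Torus.partialDeriv j (lamE θ s) x * (v j * (‖v‖ ^ 2 / 2))) (fun v => ?_) i hτ)
    exact (continuousOn_finsetSum _ fun j _ => continuousOn_finsetSum _ fun k _ =>
      (cMx j k).mul continuousOn_const).add
        (continuousOn_finsetSum _ fun j _ => (cEx j).mul continuousOn_const)

end Trajectory

/-! ## The sub-goal -/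

/-- **`engine_increment` (registered sub-goal S2 of `stub_engine`): the pathwise increment.** On a good
trajectory of a hard-sphere flow, for a classical hs-Euler solution in the dilute chamber of
`ThermoChamber`, `0 < t < T` and `τ ∈ [0, t]`,
`Obs(τ, Φ_τ z) − Obs(0, z) = ∫_{[0,τ]} kinFlux(s, Φ_s z) ds + ccRes(z, τ)`: (B1) for the mass part
(`λ⁰` is smooth as the evaluation of `Λ = Dη_σ(U_cl)` at `(1, 0, 0)`), (B2) for the free-transport
derivative inside `ccRes`, and the definition of `ccRes`; the integrands agree at interior times and are
integrable along the trajectory. -/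
theorem engine_increment : ∀ (σ : ℝ), 0 < σ → σ < 2⁻¹ → ∀ (T : ℝ) (ρ θ : ℝ → T3 → ℝ) (u : ℝ → T3 → V3),
    IsHardSphereEulerSolution σ T ρ u θ → ∀ η₃ : ℝ, ThermoChamber η₃ →
    (∀ s ∈ Ico 0 T, ∀ x, ρ s x * σ ^ 3 < η₃) → ∀ t : ℝ, 0 < t → t < T →
    ∀ (N : ℕ) (Φ : Flow σ N), ∀ z ∈ Φ.good, ∀ τ ∈ Icc 0 t,
      obs σ ρ θ u τ (Φ.flow τ z) - obs σ ρ θ u 0 z =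
        (∫ s in Icc 0 τ, kinFlux σ ρ θ u s (Φ.flow s z)) + ccRes θ u Φ z τ := by
  intro σ hσ hσ2 T ρ θ u hE η₃ hT hpack t ht htT N Φ z hz τ hτ
  -- clause 3 of `ThermoChamber`: `Λ = Dη_σ(U_cl)` is jointly smooth on `[0, T) × T³`, with explicit form
  obtain ⟨hΛ, hΛeq, -, -⟩ := (hT σ hσ).2.2 T ρ θ u hE hpack
  -- smoothness of the entropy variables
  have hlam0 : Torus.IsSmoothSpaceTimeOn (Icc 0 t) (lam0 σ ρ θ u) := by
    refine Torus.IsSmoothSpaceTimeOn.mono ?_ (Icc_subset_Ico_right htT)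
    refine (hΛ.clm_comp (ContinuousLinearMap.apply ℝ ℝ (((1 : ℝ), ((0 : V3), (0 : ℝ))) : State))).congr ?_
    rintro ⟨s, y⟩ hp
    have hs : s ∈ Ico 0 T := (mem_prod.1 hp).1
    simp only [Torus.stLift_apply, ContinuousLinearMap.apply_apply]
    rw [hΛeq s hs]
    simp [lam0]
  have hθinv : Torus.IsSmoothSpaceTimeOn (Ico 0 T) (fun s x => (θ s x)⁻¹) :=
    ContDiffOn.inv hE.smooth_temperature fun p hp =>
      (hE.temperature_pos p.1 (mem_prod.1 hp).1 (Torus.proj p.2)).ne'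
  have hlamM : Torus.IsSmoothSpaceTimeOn (Ico 0 T) (lamM θ u) := hθinv.smul hE.smooth_velocity
  have hlamE : Torus.IsSmoothSpaceTimeOn (Ico 0 T) (lamE θ) := hθinv.neg
  -- the good trajectory, (B1) for the mass part, (B2) for the free-transport derivative
  have hγ : IsHardSphereTrajectory (Torus.geometry (Fin 3)) (hsDiameter σ N) (N + 1)
      fun s => Φ.flow s z :=
    Φ.isTrajectory z hz
  have hB1 := stub_balance_B1 σ hσ hσ2 N Φ t ht (lam0 σ ρ θ u) hlam0 z hz τ hτ
  have hD : ∀ s ∈ Ico 0 T,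
      deriv (fun r : ℝ => obsK θ u s (freeFlight (Torus.geometry (Fin 3)) r (Φ.flow s z))) 0 =
        ∫ y, ((∑ j, ∑ k, Torus.partialDeriv j (fun x => lamM θ u s x k) y.1 * (y.2 j * y.2 k)) +
          ∑ j, Torus.partialDeriv j (lamE θ s) y.1 * (y.2 j * (‖y.2‖ ^ 2 / 2)))
          ∂(empiricalMeasure (Φ.flow s z)) :=
    fun s hs => (stub_balance_B2 N (lamM θ u s) (lamE θ s) (hlamM.isSmooth_slice hs)
      (hlamE.isSmooth_slice hs) (Φ.flow s z)).deriv
  -- integrability on `[0, τ]` of the (B1) integrand and of the `ccRes` integrand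
  have hIb1 : IntegrableOn (fun s => ∫ y, (Torus.timeDerivWithin (Icc 0 t) (lam0 σ ρ θ u) s y.1 +
      ∑ j, y.2 j * Torus.partialDeriv j (lam0 σ ρ θ u s) y.1) ∂(empiricalMeasure (Φ.flow s z)))
      (Icc 0 τ) volume := by
    simp only [integral_empiricalMeasure]
    exact Integrable.const_mul (integrable_finsetSum _ fun i _ =>
      (intervalIntegrable_iff_integrableOn_Icc_of_le hτ.1).1
        (traj_intervalIntegrable_smooth hγ ht hlam0 i hτ)) _
  have hIKD : IntegrableOn (fun s => (∫ y, ((∑ j, Torus.timeDeriv (lamM θ u) s y.1 j * y.2 j) +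
        Torus.timeDeriv (lamE θ) s y.1 * (‖y.2‖ ^ 2 / 2)) ∂(empiricalMeasure (Φ.flow s z))) +
      deriv (fun r : ℝ => obsK θ u s (freeFlight (Torus.geometry (Fin 3)) r (Φ.flow s z))) 0)
      (Icc 0 τ) volume := by
    have hG := kinetic_integrableOn hγ hlamM hlamE htT hτ
    rw [integrableOn_Icc_iff_integrableOn_Ioo] at hG ⊢
    refine hG.congr_fun (fun s hs => ?_) measurableSet_Ioo
    have hsT : s ∈ Ico 0 T := ⟨hs.1.le, (hs.2.trans_le hτ.2).trans htT⟩
    have hsi : s ∈ interior (Ico 0 T) := by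
      rw [interior_Ico]
      exact ⟨hs.1, (hs.2.trans_le hτ.2).trans htT⟩
    have hM' : Torus.timeDeriv (lamM θ u) s = Torus.timeDerivWithin (Ico 0 T) (lamM θ u) s :=
      funext fun x => (Torus.timeDerivWithin_of_mem_interior hsi x).symm
    have hE' : Torus.timeDeriv (lamE θ) s = Torus.timeDerivWithin (Ico 0 T) (lamE θ) s :=
      funext fun x => (Torus.timeDerivWithin_of_mem_interior hsi x).symm
    dsimp only
    rw [hD s hsT, hM', hE']
  -- the time integrands of (B1) and `ccRes` sum to the `kinFlux` integrand at interior times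
  have hK : ∫ s in Icc 0 τ, kinFlux σ ρ θ u s (Φ.flow s z) =
      (∫ s in Icc 0 τ, ∫ y, (Torus.timeDerivWithin (Icc 0 t) (lam0 σ ρ θ u) s y.1 +
        ∑ j, y.2 j * Torus.partialDeriv j (lam0 σ ρ θ u s) y.1) ∂(empiricalMeasure (Φ.flow s z))) +
      ∫ s in Icc 0 τ, ((∫ y, ((∑ j, Torus.timeDeriv (lamM θ u) s y.1 j * y.2 j) +
          Torus.timeDeriv (lamE θ) s y.1 * (‖y.2‖ ^ 2 / 2)) ∂(empiricalMeasure (Φ.flow s z))) +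
        deriv (fun r : ℝ => obsK θ u s (freeFlight (Torus.geometry (Fin 3)) r (Φ.flow s z))) 0) := by
    rw [← integral_add hIb1 hIKD, integral_Icc_eq_integral_Ioo, integral_Icc_eq_integral_Ioo]
    refine setIntegral_congr_fun measurableSet_Ioo fun s hs => ?_
    have hst : s ∈ Ioo 0 t := ⟨hs.1, hs.2.trans_le hτ.2⟩
    have hsT : s ∈ Ico 0 T := ⟨hs.1.le, hst.2.trans htT⟩
    have h0 : Torus.timeDeriv (lam0 σ ρ θ u) s = Torus.timeDerivWithin (Icc 0 t) (lam0 σ ρ θ u) s :=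
      funext fun x => (Torus.timeDerivWithin_of_mem_interior (by rw [interior_Icc]; exact hst) x).symm
    dsimp only
    rw [hD s hsT, kinFlux, h0]
    simp only [integral_empiricalMeasure]
    rw [← mul_add, ← mul_add, ← Finset.sum_add_distrib, ← Finset.sum_add_distrib]
    congr 1
    exact Finset.sum_congr rfl fun i _ => by ring
  -- `Obs = ⟨emp, λ⁰⟩ + O`, and assembly
  have hobs : ∀ (s : ℝ) (w : Config (N + 1) (Fin 3) T3), obs σ ρ θ u s w =
      (∫ y, lam0 σ ρ θ u s y.1 ∂(empiricalMeasure w)) + obsK θ u s w := by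
    intro s w
    rw [obs, obsK, integral_empiricalMeasure, integral_empiricalMeasure, integral_empiricalMeasure,
      ← mul_add, ← Finset.sum_add_distrib]
    simp only [add_assoc]
  rw [hobs, hobs, ccRes, Φ.flow_zero z hz, hK]
  linarith [hB1]

end Barycentric

end Summit.AtomisticToContinuum.HydrodynamicLimit.Theorems.MacroClosureLine

end
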